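import Literature.AnabelianGeometry.EtaleTheta.SettingModelSemidirectTempered
import Literature.AnabelianGeometry.EtaleTheta.SettingModelChiTwist
import Literature.AnabelianGeometry.SemiGraphs.TemperedFibreProduct
import Literature.AnabelianGeometry.AbsoluteAnabelian.AbsTopI.CharOpenBasis
import HarnessLib

/-!
# Root models of [EtTh] §1, χ-twisted reshape (R78 (B)): `Γ ⋊_{θ∘χ} G` is TEMPERED for every profinite `G`
# acting on `Γ = F̂₂ ×_Ẑ ℤ` through the `Ẑ^×`-twist along a pointwise-continuous `χ` (proof-only; «F4c»)

Mochizuki, *Semi-graphs of anabelioids*, Publ. RIMS **42** (2006) [SemiAnbd], Def. 3.1 (i) p. 33, Ex. 3.10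
p. 43 («`π₁^temp(X_K)` … tempered») [cite: MochizukiSemiAnbd2006, Def 3.1(i) p.33]; [EtTh] §1 p. 12
(`Π^tp_X`, `G_K`) [cite: MochizukiEtTh2009, §1 p.12]; [AbsTopI] §0 p. 9 (characteristic open subgroups of a
topologically finitely generated profinite group).  abc-iut cell, seat abc-iut-w5-d111 (gen 3); R78 cluster brick
named «(α′) temperedness of `PiTpχ`» by the F4 hand abc-iut-w5-d249 (06:29Z).  PROOF-ONLY (no definition), over:
abc-iut-L2-t1's `Gfp`/`eHat`/`iotaZ`/`mem_Gfp`/`eta` (SettingModel2Curve / SettingModelFreeGroup), abc-iut-w5-d024's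
F2 `twist`/`twistGfp` (SettingModelChiTwist, p428386), abc-iut-w5-d218's `TemperedFibreProduct.isTempered` /
`exists_openNormal_*` (TemperedFibreProduct), abc-iut-L4's `IsTopologicallyFinitelyGenerated.exists_charOpen_normal_le`
(AbsTopI/CharOpenBasis) and this seat's `Semidirect.isTempered_semidirect` (SettingModelSemidirectTempered, p428567).

RESULTS.
* `isTopologicallyFinitelyGenerated_F₂hat` — `F̂₂` is topologically generated by `η a, η b`.
* `isTempered_gfp` — `Γ = F̂₂ ×_Ẑ ℤ` is tempered (w5-d218's theorem instantiated at the model).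
* `twistGfp_condition_T` — the pro-discrete continuity hypothesis (T) of `isTempered_semidirect` HOLDS for every
  action `φ = twistGfp ∘ χ` of a profinite group `G` with `σ ↦ θ_{χ σ}(x)` continuous for each `x ∈ F̂₂` (the
  pointwise continuity F4b proves from the local constancy of the level characters of `χ`): given an open normal
  `N₁ ≤ Γ`, take a slice `(V × 0) ∩ Γ ⊆ N₁` (`V ⊴ F̂₂` open), a CHARACTERISTIC open normal `V₀ ≤ V` ([AbsTopI] §0:
  `F̂₂` is topologically finitely generated), `N₂ := (V₀ × 0) ∩ Γ` — stable under every `θ_u × id` because `θ_u`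
  is a topological automorphism — and `W := {σ | θ_{χσ}(x) x⁻¹ ∈ V₀ ∀ x}`, an open normal subgroup of `G`: it is
  the kernel of the action on the finite group `F̂₂/V₀`, and it contains the open set `{σ | θ_{χσ}(η b) ∈ η b·V₀}`
  since `θ` fixes `η a` and `F̂₂/V₀` is generated by the images of `η a`, `η b`.
* `isTempered_gfp_twist_semidirect` — hence **`Γ ⋊[φ] G` is tempered** for any group topology on the semidirect
  product making `(left, right)` a topological embedding: the `isTempered` field of `GroupLevelData (curveχ p)` once
  F4's `PiTpχ p := Γ ⋊[twistGfp ∘ chi p] G_{ℚ_p}` lands (instantiate with `G := GQp p`, `χ := chi p`).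
SEMI-SYNTHETIC MODEL PLUMBING, consistency evidence only; nothing of [EtTh] asserted; no side taken on [IUTchIII]
Cor. 3.12.
-/

noncomputable section

namespace Literature.AnabelianGeometry.EtaleTheta.SettingModel

open Literature.AnabelianGeometry.SemiGraphs Literature.AnabelianGeometry.AbsoluteAnabelian
open _root_.Topology _root_.Filter Function

/-! ### `F̂₂` is topologically finitely generated; `Γ` is tempered -/

/-- The subgroup generated by `η a`, `η b` is dense in `F̂₂` (it is `η(F₂)`, and `η` has dense range).
[cite: MochizukiEtTh2009, §1 p.12] -/
theorem topologicalClosure_closure_eta_pair :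
    (Subgroup.closure ({eta (FreeGroup.of 0), eta (FreeGroup.of 1)} : Set F₂hatT)).topologicalClosure = ⊤ := by
  have hr : (Set.range (FreeGroup.of : Fin 2 → F₂)) = {FreeGroup.of 0, FreeGroup.of 1} := by
    ext g
    simp only [Set.mem_range, Set.mem_insert_iff, Set.mem_singleton_iff]
    constructor
    · rintro ⟨i, rfl⟩
      fin_cases i
      · exact Or.inl rfl
      · exact Or.inr rfl
    · rintro (rfl | rfl)
      exacts [⟨0, rfl⟩, ⟨1, rfl⟩]
  have hcl : Subgroup.closure ({eta (FreeGroup.of 0), eta (FreeGroup.of 1)} : Set F₂hatT) = eta.range := by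
    rw [← Set.image_pair, ← hr, ← MonoidHom.map_closure, FreeGroup.closure_range_of, ← MonoidHom.range_eq_map]
  rw [hcl, ← SetLike.coe_set_eq, Subgroup.topologicalClosure_coe, Subgroup.coe_top, MonoidHom.coe_range]
  exact denseRange_eta.closure_range

/-- `F̂₂` is topologically finitely generated: `η a`, `η b` generate a dense subgroup
([AbsTopI] §0 p. 8; [EtTh] p. 12 «a profinite free group on 2 generators»). [cite: MochizukiAbsTopI2012, §0 p.8] -/
theorem isTopologicallyFinitelyGenerated_F₂hat : IsTopologicallyFinitelyGenerated F₂hatT := by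
  classical
  refine ⟨⟨{eta (FreeGroup.of 0), eta (FreeGroup.of 1)}, ?_⟩⟩
  rw [Finset.coe_pair]
  exact topologicalClosure_closure_eta_pair

/-- **`Γ = F̂₂ ×_Ẑ ℤ` is tempered** (abc-iut-w5-d218's `TemperedFibreProduct.isTempered` at the model's
`eHat`, `iotaZ`, `Gfp`). [cite: MochizukiSemiAnbd2006, Def 3.1(i) p.33] -/
theorem isTempered_gfp : IsTempered Gfp :=
  TemperedFibreProduct.isTempered eHat iotaZ Gfp mem_Gfp

/-! ### The hypothesis (T) for the twist action -/

/-- A closed subgroup of `F̂₂` containing `η a` and `η b` is everything. [cite: MochizukiEtTh2009, §1 p.12] -/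
theorem eq_top_of_isClosed_of_eta_mem (H : Subgroup F₂hatT) (hH : IsClosed (H : Set F₂hatT))
    (h0 : eta (FreeGroup.of 0) ∈ H) (h1 : eta (FreeGroup.of 1) ∈ H) : H = ⊤ := by
  rw [eq_top_iff, ← topologicalClosure_closure_eta_pair]
  refine Subgroup.topologicalClosure_minimal _ ((Subgroup.closure_le H).mpr ?_) hH
  rintro x (rfl | rfl)
  exacts [h0, h1]

/-- **The hypothesis (T) of `Semidirect.isTempered_semidirect` holds for the twist action on `Γ`.**  For a
profinite `G`, `χ : G →* Aut(Ẑ)` with `σ ↦ θ_{χσ}(x)` continuous for every `x`, and `φ = twistGfp ∘ χ`: every open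
normal `N₁ ≤ Γ` contains an open normal `N₂ = (V₀ × 0) ∩ Γ` (`V₀ ≤ F̂₂` characteristic open) stable under all of
`φ(G)`, modulo which the open normal subgroup `W = Ker(G → Aut(F̂₂/V₀))` acts trivially.
[cite: MochizukiAbsTopI2012, §0 p.9] -/
theorem twistGfp_condition_T {G : Type*} [Group G] [TopologicalSpace G] [IsTopologicalGroup G]
    [CompactSpace G] [TotallyDisconnectedSpace G]
    (χ : G →* MulAut ZH) (hcont : ∀ x : F₂hatT, Continuous fun σ => twist (χ σ) x)
    {φ : G →* MulAut Gfp} (hφ : ∀ (σ : G) (q : Gfp), φ σ q = twistGfp (χ σ) q)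
    (N₁ : OpenNormalSubgroup Gfp) :
    ∃ N₂ : OpenNormalSubgroup Gfp, N₂ ≤ N₁ ∧
      (∀ g : G, ∀ ⦃a⦄, a ∈ (N₂ : Subgroup Gfp) → φ g a ∈ (N₂ : Subgroup Gfp)) ∧
      ∃ W : OpenNormalSubgroup G, ∀ ⦃b⦄, b ∈ (W : Subgroup G) → ∀ n : Gfp,
        n * (φ b n)⁻¹ ∈ (N₂ : Subgroup Gfp) := by
  classical
  -- Step A: a slice `(V × 0) ∩ Γ ⊆ N₁`
  obtain ⟨V, N, -, hN, hNN₁⟩ := TemperedFibreProduct.exists_openNormal_le_of_mem_nhds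
    (P := F₂hatT) Gfp (N₁.toOpenSubgroup.mem_nhds_one)
  -- Step B: a characteristic open normal `V₀ ≤ V`
  haveI : Finite (F₂hatT ⧸ (V : Subgroup F₂hatT)) := Subgroup.quotient_finite_of_isOpen _ V.isOpen
  haveI : (V : Subgroup F₂hatT).FiniteIndex := Subgroup.finiteIndex_of_finite_quotient
  obtain ⟨V₀, hV₀n, hV₀o, -, hV₀c, hV₀V⟩ :=
    isTopologicallyFinitelyGenerated_F₂hat.exists_charOpen_normal_le (V : Subgroup F₂hatT) V.isOpen
  haveI := hV₀n
  let V₀' : OpenNormalSubgroup F₂hatT := { toSubgroup := V₀, isOpen' := hV₀o, isNormal' := hV₀n }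
  have hV₀twist : ∀ (u : MulAut ZH) {x : F₂hatT}, x ∈ V₀ → twist u x ∈ V₀ := by
    intro u x hx
    have h := hV₀c (twist u)
    rw [← h]
    exact Subgroup.mem_map_of_mem _ hx
  obtain ⟨N₂, -, hN₂⟩ := TemperedFibreProduct.exists_openNormal_mem_iff (P := F₂hatT) Gfp V₀'
  have hN₂mem : ∀ q : Gfp, q ∈ (N₂ : Subgroup Gfp) ↔
      (q : F₂hatT × Multiplicative ℤ).1 ∈ V₀ ∧ (q : F₂hatT × Multiplicative ℤ).2 = 1 := fun q => hN₂ q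
  refine ⟨N₂, ?_, ?_, ?_⟩
  · -- `N₂ ≤ N ≤ N₁`
    intro q hq
    have hq' := (hN₂ q).mp hq
    exact hNN₁ ((hN q).mpr ⟨hV₀V hq'.1, hq'.2⟩)
  · -- stability under `φ(G)`
    intro g q hq
    rw [hN₂mem] at hq ⊢
    rw [hφ, coe_twistGfp]
    exact ⟨hV₀twist _ hq.1, hq.2⟩
  · -- Step C: `W = Ker(G → Aut(F̂₂/V₀))`
    have hsub : ∀ σ : G, (∀ x : F₂hatT, twist (χ σ) x * x⁻¹ ∈ V₀) →
        ∀ x : F₂hatT, x * (twist (χ σ) x)⁻¹ ∈ V₀ := by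
      intro σ h x
      have := V₀.inv_mem (h x)
      rwa [mul_inv_rev, inv_inv] at this
    let S : Set G := {σ | ∀ x : F₂hatT, twist (χ σ) x * x⁻¹ ∈ V₀}
    obtain ⟨W, hW⟩ : ∃ W : Subgroup G, ∀ σ, σ ∈ W ↔ ∀ x : F₂hatT, twist (χ σ) x * x⁻¹ ∈ V₀ := by
      refine ⟨⟨⟨⟨S, ?_⟩, ?_⟩, ?_⟩, fun σ => Iff.rfl⟩
      · intro σ τ hσ hτ x
        simp only [S, Set.mem_setOf_eq] at hσ hτ ⊢
        rw [map_mul, twist_mul]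
        have e : twist (χ σ) (twist (χ τ) x) * x⁻¹ =
            (twist (χ σ) (twist (χ τ) x) * (twist (χ τ) x)⁻¹) * (twist (χ τ) x * x⁻¹) := by group
        rw [e]
        exact V₀.mul_mem (hσ _) (hτ x)
      · intro x
        simp only [map_one, twist_one, mul_inv_cancel]
        exact V₀.one_mem
      · intro σ hσ x
        simp only [S, Set.mem_setOf_eq] at hσ ⊢
        -- `x = θ_σ (θ_{σ⁻¹} x)`
        have hx : twist (χ σ) (twist (χ σ⁻¹) x) = x := by
          rw [← twist_mul, ← map_mul, mul_inv_cancel, map_one, twist_one]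
        have h := V₀.inv_mem (hσ (twist (χ σ⁻¹) x))
        rw [hx, mul_inv_rev, inv_inv] at h
        exact h
    -- `W` is normal
    have hWn : W.Normal := by
      refine ⟨fun σ hσ τ => ?_⟩
      rw [hW] at hσ ⊢
      intro x
      set y := twist (χ τ⁻¹) x with hy
      have hx : x = twist (χ τ) y := by
        rw [hy, ← twist_mul, ← map_mul, mul_inv_cancel, map_one, twist_one]
      rw [map_mul, map_mul, twist_mul, twist_mul, hx, ← twist_mul (χ τ⁻¹), ← map_mul, inv_mul_cancel,
        map_one, twist_one, ← map_inv, ← map_mul]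
      exact hV₀twist _ (hσ y)
    -- `W` contains the open set `S = {σ | θ_{χσ}(η b) (η b)⁻¹ ∈ V₀}`, hence is open
    have hS : IsOpen {σ : G | twist (χ σ) (eta (FreeGroup.of 1)) * (eta (FreeGroup.of 1))⁻¹ ∈ V₀} :=
      hV₀o.preimage ((hcont _).mul continuous_const)
    have hSW : {σ : G | twist (χ σ) (eta (FreeGroup.of 1)) * (eta (FreeGroup.of 1))⁻¹ ∈ V₀} ⊆ (W : Set G) := by
      intro σ hσ
      rw [SetLike.mem_coe, hW]
      -- the fixator `{x | θ x · x⁻¹ ∈ V₀}` is a closed subgroup containing `η a`, `η b`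
      let F : Set F₂hatT := {x | twist (χ σ) x * x⁻¹ ∈ V₀}
      obtain ⟨Fix, hFix⟩ : ∃ Fix : Subgroup F₂hatT, ∀ x, x ∈ Fix ↔ twist (χ σ) x * x⁻¹ ∈ V₀ := by
        refine ⟨⟨⟨⟨F, ?_⟩, ?_⟩, ?_⟩, fun x => Iff.rfl⟩
        · intro x y hx hy
          simp only [F, Set.mem_setOf_eq] at hx hy ⊢
          rw [map_mul]
          have e : twist (χ σ) x * twist (χ σ) y * (x * y)⁻¹ =
              (twist (χ σ) x * x⁻¹) * (x * (twist (χ σ) y * y⁻¹) * x⁻¹) := by group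
          rw [e]
          exact V₀.mul_mem hx (hV₀n.conj_mem _ hy x)
        · show twist (χ σ) 1 * 1⁻¹ ∈ V₀
          rw [map_one, inv_one, mul_one]
          exact V₀.one_mem
        · intro x hx
          simp only [F, Set.mem_setOf_eq] at hx ⊢
          rw [map_inv, inv_inv]
          -- `(θx)⁻¹ x = x⁻¹ (x (θx)⁻¹) x`
          have h1 : x * (twist (χ σ) x)⁻¹ ∈ V₀ := by
            have := V₀.inv_mem hx
            rwa [mul_inv_rev, inv_inv] at this
          have h2 := hV₀n.conj_mem _ h1 x⁻¹
          rwa [inv_inv, ← mul_assoc, inv_mul_cancel, one_mul] at h2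
      have hFixc : IsClosed (Fix : Set F₂hatT) := by
        have e : (Fix : Set F₂hatT) = (fun x => twist (χ σ) x * x⁻¹) ⁻¹' (V₀ : Set F₂hatT) := by
          ext x; exact hFix x
        rw [e]
        exact (OpenSubgroup.isClosed ⟨V₀, hV₀o⟩).preimage ((twist (χ σ)).continuous.mul continuous_inv)
      have hFix0 : eta (FreeGroup.of 0) ∈ Fix := by
        rw [hFix, twist_eta_of_zero, mul_inv_cancel]
        exact V₀.one_mem
      have hFix1 : eta (FreeGroup.of 1) ∈ Fix := (hFix _).mpr hσ
      have htop := eq_top_of_isClosed_of_eta_mem Fix hFixc hFix0 hFix1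
      intro x
      exact (hFix x).mp (htop ▸ Subgroup.mem_top x)
    have h1S : (1 : G) ∈ {σ : G | twist (χ σ) (eta (FreeGroup.of 1)) * (eta (FreeGroup.of 1))⁻¹ ∈ V₀} := by
      show twist (χ 1) (eta (FreeGroup.of 1)) * (eta (FreeGroup.of 1))⁻¹ ∈ V₀
      rw [map_one, twist_one, mul_inv_cancel]
      exact V₀.one_mem
    have hWo : IsOpen (W : Set G) :=
      Subgroup.isOpen_of_mem_nhds W (Filter.mem_of_superset (hS.mem_nhds h1S) hSW)
    refine ⟨{ toSubgroup := W, isOpen' := hWo, isNormal' := hWn }, fun b hb n => ?_⟩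
    have hb' : ∀ x : F₂hatT, twist (χ b) x * x⁻¹ ∈ V₀ := (hW b).mp hb
    rw [hN₂mem]
    refine ⟨?_, ?_⟩
    · show ((n : F₂hatT × Multiplicative ℤ) * ((φ b n : Gfp) : F₂hatT × Multiplicative ℤ)⁻¹).1 ∈ V₀
      rw [hφ, coe_twistGfp, Prod.fst_mul, Prod.fst_inv]
      exact hsub b hb' _
    · show ((n : F₂hatT × Multiplicative ℤ) * ((φ b n : Gfp) : F₂hatT × Multiplicative ℤ)⁻¹).2 = 1
      rw [hφ, coe_twistGfp, Prod.snd_mul, Prod.snd_inv, mul_inv_cancel]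

/-- **`Γ ⋊_{θ∘χ} G` is tempered** ([SemiAnbd] Def. 3.1 (i) / Ex. 3.10 at the χ-twisted root model): for a
profinite `G`, `χ : G →* Aut(Ẑ)` with pointwise-continuous twists, the action `φ = twistGfp ∘ χ` on
`Γ = F̂₂ ×_Ẑ ℤ`, and ANY group topology on `Γ ⋊[φ] G` for which `(left, right)` is a topological embedding.
At F4's `PiTpχ p` take `G := GQp p`, `χ := chi p`. [cite: MochizukiSemiAnbd2006, Ex 3.10 p.43] -/
theorem isTempered_gfp_twist_semidirect {G : Type*} [Group G] [TopologicalSpace G] [IsTopologicalGroup G]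
    [CompactSpace G] [T2Space G] [TotallyDisconnectedSpace G]
    (χ : G →* MulAut ZH) (hcont : ∀ x : F₂hatT, Continuous fun σ => twist (χ σ) x)
    {φ : G →* MulAut Gfp} (hφ : ∀ (σ : G) (q : Gfp), φ σ q = twistGfp (χ σ) q)
    [TopologicalSpace (Gfp ⋊[φ] G)] [IsTopologicalGroup (Gfp ⋊[φ] G)]
    (hι : IsInducing fun g : Gfp ⋊[φ] G => (g.left, g.right)) : IsTempered (Gfp ⋊[φ] G) :=
  Semidirect.isTempered_semidirect hι isTempered_gfp (twistGfp_condition_T χ hcont hφ)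

end Literature.AnabelianGeometry.EtaleTheta.SettingModel

end
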